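import Summits.Ventures.Crystal3D.Theorems.StickyWulffConstantGenericWallFloorHRowWalk
import Summits.Ventures.Crystal3D.Theorems.StickyWulffConstantGenericWallFloorCapStartBarlow
import HarnessLib

/-!
# h-ROW START on a moved Barlow plate: at an h-layer the lattice dozen IS the anticuboctahedron, so the h-row invariant holds at launch
# (crux `GenericWallFloor`, stmt-Ventures-19480, kernel G; line «LAYER ROWS» of cf-p1 (ccix)/(ccx), R1 h-layer half, sequel of `…HRowWalk` p715926)

HONEST FRAMING. Venture `Summits/Ventures/Crystal3D` (cell `crystal3d-full`), route `route-Ventures-StickyWulffConstant`, helper for the crux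
`GenericWallFloor` (stmt-Ventures-19480) / consumer `TextureLiminfV5` (stmt-Ventures-23912).  Lattice bookkeeping on the Literature's Barlow stackings
(the four bilayer lemmas of `…CapStartBarlow`); standard axioms; no certificate, no wall law; F-C1 not moved.

THE POINT.  An h-LAYER `k` of the stacking `σ` is one with `σ (k−1) ≠ σ k`.  Two types:
* type A (`σ (k−1) = −1`, `σ k = 1`): the twelve lattice neighbours of a layer-`k` site `p` are EXACTLY `p + hcpSlots` (hexagon, upper triple, basal
  mirror of the upper triple): `barlow_hA_add_hcpSlot_mem`;
* type B (`σ (k−1) = 1`, `σ k = −1`): they are `p − hcpSlots` (the point-reflected anticuboctahedron): `barlow_hB_sub_hcpSlot_mem`;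
so in the moved plate `L·B(σ) + s₀`, inside any `X` containing the stacking sites within distance `1` of `p`, the h-row walker launched one step along the
row from `p` satisfies the invariant of `…HRowWalk`:
* **`hRowInv_start_barlow_A`** — `HRowInv X L u (L p + s₀ + L u)` for every in-plane slot `u` (frame `L`);
* **`hRowInv_start_barlow_B`** — `HRowInv X (neg ≫ L) u (L p + s₀ + L (−u))` (frame `x ↦ L (−x)`; to walk along `L u_act` take `u = −u_act`).
WHAT THIS IS NOT: no end analysis (that is `hRow_end` + the certificate), no family / injectivity / line count (next file), nothing on c-layers; F-C1 not moved.
-/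

noncomputable section

namespace Summit.Ventures.Crystal3D.Theorems

open Finset
open Literature.MathematicalPhysics.StatisticalMechanics
open scoped InnerProductSpace

variable {X : Finset (EuclideanSpace ℝ (Fin 3))}

/-! ### The anticuboctahedral dozen of an h-layer site, in the model -/

/-- **Type A h-layer (`σ (k−1) = −1`, `σ k = 1`): every h-slot from a layer-`k` site is a stacking site** (the hexagon in layer `k`, the upper triple in
layer `k + 1`, the mirrored triple in layer `k − 1`). -/
theorem barlow_hA_add_hcpSlot_mem (σ : ℤ → ℤ) (k i j : ℤ) (hk' : σ (k - 1) = -1) (hk : σ k = 1)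
    {s : EuclideanSpace ℝ (Fin 3)} (hs : s ∈ hcpSlots) :
    ∃ m : ℤ, barlowPos 1 (Real.sqrt (2 / 3)) σ k i j + s ∈ barlowLayer 1 (Real.sqrt (2 / 3)) σ m := by
  rcases mem_hcpSlots.1 hs with ⟨hs', h0⟩ | ⟨t, ⟨ht, ht0⟩, rfl⟩
  · rcases barlow_delta_add_slot_mem σ k i j hk hs' h0 with h | h
    · exact ⟨k, h⟩
    · exact ⟨k + 1, h⟩
  · rcases slot_apply_two_cases ht with h2 | h2 | h2
    · -- an in-plane slot is its own mirror
      rw [basalMirror_of_inPlane h2]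
      rcases barlow_delta_add_slot_mem σ k i j hk ht ht0 with h | h
      · exact ⟨k, h⟩
      · exact ⟨k + 1, h⟩
    · exact ⟨k - 1, barlow_nabla_sub_slot_mem σ k i j hk' ht h2⟩
    · exfalso; rw [h2] at ht0; linarith [Real.sqrt_pos.2 (show (0 : ℝ) < 2 / 3 by norm_num)]

/-- **Type B h-layer (`σ (k−1) = 1`, `σ k = −1`): every NEGATED h-slot from a layer-`k` site is a stacking site** (the dozen is the point-reflected
anticuboctahedron `p − hcpSlots`). -/
theorem barlow_hB_sub_hcpSlot_mem (σ : ℤ → ℤ) (k i j : ℤ) (hk' : σ (k - 1) = 1) (hk : σ k = -1)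
    {s : EuclideanSpace ℝ (Fin 3)} (hs : s ∈ hcpSlots) :
    ∃ m : ℤ, barlowPos 1 (Real.sqrt (2 / 3)) σ k i j + -s ∈ barlowLayer 1 (Real.sqrt (2 / 3)) σ m := by
  have hrpos : 0 < Real.sqrt (2 / 3) := Real.sqrt_pos.2 (by norm_num)
  rcases mem_hcpSlots.1 hs with ⟨hs', h0⟩ | ⟨t, ⟨ht, ht0⟩, rfl⟩
  · have hns : -s ∈ fccSlots := neg_mem_fccSlots hs'
    rcases slot_apply_two_cases hs' with h2 | h2 | h2
    · -- in-plane: `−s` is in-plane, its own mirror, and lands in the bilayer `k, k+1` of the ∇ frame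
      have hm : basalMirror (-s) = -s := basalMirror_of_inPlane (by rw [PiLp.neg_apply, h2, neg_zero])
      rcases barlow_nabla_add_slot_mem σ k i j hk hns (by rw [PiLp.neg_apply, h2, neg_zero]) with h | h
      · exact ⟨k, by rwa [hm] at h⟩
      · exact ⟨k + 1, by rwa [hm] at h⟩
    · -- an upper slot: `−s` is a lower slot and lands in layer `k − 1` (Δ step below)
      exact ⟨k - 1, barlow_delta_sub_slot_mem σ k i j hk' hns (by rw [PiLp.neg_apply, h2])⟩
    · exfalso; rw [h2] at h0; linarith
  · -- a mirrored upper slot: `−basalMirror t = basalMirror (−t)` with `(−t)₂ ≤ 0` lands in layers `k, k+1`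
    have hnt : -t ∈ fccSlots := neg_mem_fccSlots ht
    have hm : -basalMirror t = basalMirror (-t) := (map_neg basalMirror t).symm
    rw [hm]
    rcases barlow_nabla_add_slot_mem σ k i j hk hnt (by rw [PiLp.neg_apply]; linarith) with h | h
    · exact ⟨k, h⟩
    · exact ⟨k + 1, h⟩

/-! ### The moved plate: the h-row invariant at launch -/

section Moved

variable (σ : ℤ → ℤ) (L : EuclideanSpace ℝ (Fin 3) ≃ₗᵢ[ℝ] EuclideanSpace ℝ (Fin 3)) (s₀ : EuclideanSpace ℝ (Fin 3)) (k i j : ℤ)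

/-- Local completeness of the moved plate around `p₀ = barlowPos σ k i j`: a model displacement `d` of norm `≤ 1` that lands on a stacking site is
occupied after the motion. -/
private theorem mem_of_site' {σ : ℤ → ℤ} {L : EuclideanSpace ℝ (Fin 3) ≃ₗᵢ[ℝ] EuclideanSpace ℝ (Fin 3)}
    {s₀ : EuclideanSpace ℝ (Fin 3)} {k i j : ℤ}
    (hX : ∀ q ∈ barlowStacking 1 (Real.sqrt (2 / 3)) σ, dist q (barlowPos 1 (Real.sqrt (2 / 3)) σ k i j) ≤ 1 → L q + s₀ ∈ X)
    {m : ℤ} {d : EuclideanSpace ℝ (Fin 3)} (hd : ‖d‖ ≤ 1)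
    (hmem : barlowPos 1 (Real.sqrt (2 / 3)) σ k i j + d ∈ barlowLayer 1 (Real.sqrt (2 / 3)) σ m) :
    L (barlowPos 1 (Real.sqrt (2 / 3)) σ k i j) + s₀ + L d ∈ X := by
  have h := hX _ (barlowLayer_subset_stacking σ m hmem) (by rw [dist_comm, dist_self_add_right]; exact hd)
  rw [map_add] at h
  convert h using 1
  abel

/-- **h-ROW START, type A.**  `σ (k−1) = −1`, `σ k = 1`, `p₀ = barlowPos σ k i j`, the stacking sites within distance `1` of `p₀` occupied after the
motion `p ↦ L p + s₀`, `u` an in-plane slot.  Then the walker one step along the row, at `L p₀ + s₀ + L u` with frame `L` and direction `u`, satisfies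
`HRowInv` (its predecessor `L p₀ + s₀` is h-FULL). -/
theorem hRowInv_start_barlow_A (hk' : σ (k - 1) = -1) (hk : σ k = 1)
    (hX : ∀ q ∈ barlowStacking 1 (Real.sqrt (2 / 3)) σ, dist q (barlowPos 1 (Real.sqrt (2 / 3)) σ k i j) ≤ 1 → L q + s₀ ∈ X)
    {u : EuclideanSpace ℝ (Fin 3)} (hu : u ∈ fccSlots) (hu2 : u 2 = 0) :
    HRowInv X L u (L (barlowPos 1 (Real.sqrt (2 / 3)) σ k i j) + s₀ + L u) := by
  have hsite : ∀ s ∈ hcpSlots, L (barlowPos 1 (Real.sqrt (2 / 3)) σ k i j) + s₀ + L s ∈ X := by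
    intro s hs
    obtain ⟨m, hm⟩ := barlow_hA_add_hcpSlot_mem σ k i j hk' hk hs
    exact mem_of_site' hX (by rw [norm_eq_one_of_mem_hcpSlots hs]) hm
  have hp : L (barlowPos 1 (Real.sqrt (2 / 3)) σ k i j) + s₀ ∈ X := by
    have := hX _ (barlowPos_mem k i j) (by rw [dist_self]; norm_num)
    exact this
  refine ⟨hsite u (mem_hcpSlots_of_inPlane hu hu2), by rw [add_sub_cancel_right]; exact hp, fun w hw => ?_⟩
  rw [add_sub_cancel_right]; exact hsite w hw

/-- **h-ROW START, type B.**  `σ (k−1) = 1`, `σ k = −1`: the dozen is `p₀ − hcpSlots`, i.e. `p₀ + F·hcpSlots` for the frame `F = neg ≫ L` (`F x = L (−x)`);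
the walker at `L p₀ + s₀ + L (−u)` with frame `F` and direction `u` satisfies `HRowInv` (walk along `L u_act` by taking `u = −u_act`). -/
theorem hRowInv_start_barlow_B (hk' : σ (k - 1) = 1) (hk : σ k = -1)
    (hX : ∀ q ∈ barlowStacking 1 (Real.sqrt (2 / 3)) σ, dist q (barlowPos 1 (Real.sqrt (2 / 3)) σ k i j) ≤ 1 → L q + s₀ ∈ X)
    {u : EuclideanSpace ℝ (Fin 3)} (hu : u ∈ fccSlots) (hu2 : u 2 = 0) :
    HRowInv X ((LinearIsometryEquiv.neg ℝ).trans L) u (L (barlowPos 1 (Real.sqrt (2 / 3)) σ k i j) + s₀ + L (-u)) := by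
  have hF : ∀ x : EuclideanSpace ℝ (Fin 3), ((LinearIsometryEquiv.neg ℝ).trans L) x = L (-x) := fun x => rfl
  have hsite : ∀ s ∈ hcpSlots, L (barlowPos 1 (Real.sqrt (2 / 3)) σ k i j) + s₀ + L (-s) ∈ X := by
    intro s hs
    obtain ⟨m, hm⟩ := barlow_hB_sub_hcpSlot_mem σ k i j hk' hk hs
    exact mem_of_site' hX (by rw [norm_neg, norm_eq_one_of_mem_hcpSlots hs]) hm
  have hp : L (barlowPos 1 (Real.sqrt (2 / 3)) σ k i j) + s₀ ∈ X := by
    have := hX _ (barlowPos_mem k i j) (by rw [dist_self]; norm_num)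
    exact this
  refine ⟨hsite u (mem_hcpSlots_of_inPlane hu hu2), ?_, fun w hw => ?_⟩
  · rw [hF, add_sub_cancel_right]; exact hp
  · rw [hF, hF, add_sub_cancel_right]; exact hsite w hw

end Moved

end Summit.Ventures.Crystal3D.Theorems

end
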